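import Literature.NumberTheory.EllipticCurves.FormalGroupHasseInvariantProofs
import Literature.NumberTheory.EllipticCurves.FormalInvariantDerivation
import Literature.AlgebraicGeometry.Resolution.MvPowerSeriesChainRule
import Literature.RingTheory.FormalGroups.HochschildFormulaProofs
import Mathlib.NumberTheory.Wilson
import HarnessLib

/-!
# The formal leaf `y = exp_{E'}(log_E x)` is `p`-closed when the Hasse invariants agree
(Bost 2001, Prop. 3.9 (2) for `E × E'`; proofs only)

Topic `Literature/NumberTheory/EllipticCurves`; a proofs-only file (theorems only, no definition,
no named fact). It is the characteristic-`p` half of the `p`-adic input of Bost's Faltings-free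
proof of the isogeny theorem for elliptic curves over `ℚ` (J.-B. Bost, Publ. Math. IHÉS 93
(2001), Cor. 2.5, serving the tree's named fact `WeierstrassCurve.isIsogenous_iff_frobeniusTrace_eq`):

> "for any prime `p ∤ N`, the fact that the `p`-th power map on `Lie E_{𝔽_p}` (resp. on
> `Lie E'_{𝔽_p}`) is given by the multiplication by `a_p(E)` (resp. by `a_p(E')`) shows that
> the reduction of `h` modulo `p` is stable under `p`-th power if and only if
> `a_p(E) = a_p(E')` holds modulo `p`" (Bost, loc. cit., proof of Cor. 2.5, p. 173), and
> "the `p`-integrability hypothesis on `F` also shows that, for almost every `p`, the reductions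
> `v_{𝔽_p}` of these sections [`v = ∂/∂x₁ + a ∂/∂x₂`] have vanishing `p`-th powers"
> (§3.4.1, p. 190).

In the formal group of a Weierstrass curve `W` over a ring `R` of odd prime characteristic `p`
(parameter `z = -x/y`, invariant differential `ω(z)dz`, `formalInvDiff`, its inverse `η`,
`formalEta`, and the invariant derivation `D = η·d/dz`, `formalInvariantDerivation(Mv)`):

* `iterate_derivative_formalInvDiff_add_smul_pow` — `(d/dz)^{p-1} ω = -A·ωᵖ`, `A = hasseCoeff`
  the Hasse invariant: the coefficient form of the tree's level-one Atkin–Swinnerton-Dyer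
  identity `c_{np-1} = A c_{n-1}^p` (`coeff_formalInvDiff_mul_prime`) and Wilson's theorem;
* `iterate_prime_formalInvariantDerivationMv` — **`Dᵖ = A·D`**: the `p`-th power map on the
  (one-dimensional, restricted) Lie algebra of the formal group is multiplication by the Hasse
  invariant (Bost, footnote (2): Katz–Mazur (12.4.1.2)–(12.4.1.3)); from Hochschild's formula
  `(ωD)ᵖ = ωᵖDᵖ + (ωD)ᵖ⁻¹(ω)·D` with `ωD = d/dz` and `(d/dz)ᵖ = 0`;
* `iterate_prime_add_formalInvariantDerivationMv` — for two curves `W, W'` with the same Hasse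
  invariant, `θ = D_{x} + D'_{y}` on `R⟦x, y⟧` has `θᵖ = A·θ` (the line `h` spanned by `θ` in
  `Lie(Ê × Ê')` is closed under `p`-th powers);
* `iterate_prime_leafDerivation_eq_zero` — **the normalised generator `ξ = ω(x)·θ =
  ∂/∂x + ω(x)η'(y)·∂/∂y` of that line has `ξᵖ = 0`** (Hochschild's formula once more). Its
  formal flow through the origin is the graph of `y = exp_{W'}(log_W x)`; the vanishing `ξᵖ = 0`
  is what gives `n!·[xⁿ]f(x, y(x)) ∈ p^{⌊n/p⌋}ℤ_(p)` in characteristic zero (Bost, Prop. 3.9 (2);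
  the sequel file).

Also: `coeff_iterate_derivative`, `coeff_iterate_pderiv` (coefficients of iterated (partial)
derivatives), `iterate_prime_derivative_eq_zero`, `iterate_prime_pderiv_eq_zero`
(`(d/dz)ᵖ = 0` in characteristic `p`), `pderiv_pderiv_comm`, `iterate_prime_add_apply_of_comm`
(`(u+v)ᵖ = uᵖ + vᵖ` for commuting linear maps in characteristic `p`), `leafDerivation_apply`
(`ξ = ∂ₓ + ω(x)η'(y)∂_y`), `iterate_leafDerivation_subst_X_zero` (`ξ` is `d/dx` on series in `x`).

## References

* J.-B. Bost, *Algebraic leaves of algebraic foliations over number fields*, Publ. Math. IHÉS 93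
  (2001), 161–221: §2.3.1 and footnote (2), Cor. 2.5 (proof), §3.4.1, Prop. 3.9.
  [Bost2001AlgebraicLeaves]
* N. M. Katz, B. Mazur, *Arithmetic moduli of elliptic curves* (1985), (12.4.1.2)–(12.4.1.3).
* G. Hochschild, Trans. AMS 79 (1955), Lemma 1 (`HochschildFormulaProofs`). [Hochschild1955]
* J. H. Silverman, *AEC* (2009), IV.1, V.4.1 (Hasse invariant `A_p`, `a_p ≡ A_p`). [SilvermanAEC2009]
-/

noncomputable section

open PowerSeries Finset Literature.RingTheory.FormalGroups
open Literature.AlgebraicGeometry.Resolution (MvPowerSeries.pderiv MvPowerSeries.coeff_pderiv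
  MvPowerSeries.pderiv_X MvPowerSeries.pderiv_C MvPowerSeries.pderiv_powerSeries_subst_X)

namespace Literature.NumberTheory.EllipticCurves

variable {R : Type*} [CommRing R]

/-! ### Coefficients of iterated derivatives; `(d/dz)ᵖ = 0` in characteristic `p` -/

/-- `[zⁿ] f⁽ᵐ⁾ = (n+1)(n+2)⋯(n+m) · [z^{n+m}] f`. [folklore] -/
theorem coeff_iterate_derivative (f : R⟦X⟧) (m n : ℕ) :
    coeff n ((d⁄dX R)^[m] f) = ((n + 1).ascFactorial m : R) * coeff (n + m) f := by
  induction m generalizing f with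
  | zero => simp
  | succ m ih =>
    rw [Function.iterate_succ_apply, ih, PowerSeries.coeff_derivative, Nat.ascFactorial_succ,
      show n + (m + 1) = n + m + 1 by ring]
    push_cast
    ring

/-- `[xᵉ] ∂ᵢᵐ f = (eᵢ+1)(eᵢ+2)⋯(eᵢ+m) · [x^{e + m·1ᵢ}] f`. [folklore] -/
theorem coeff_iterate_pderiv {σ : Type*} (i : σ) (f : MvPowerSeries σ R) (m : ℕ) (e : σ →₀ ℕ) :
    MvPowerSeries.coeff e ((MvPowerSeries.pderiv i)^[m] f) =
      ((e i + 1).ascFactorial m : R) * MvPowerSeries.coeff (e + Finsupp.single i m) f := by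
  induction m generalizing f with
  | zero => simp
  | succ m ih =>
    rw [Function.iterate_succ_apply, ih, MvPowerSeries.coeff_pderiv, Nat.ascFactorial_succ,
      add_assoc, ← Finsupp.single_add, Finsupp.add_apply, Finsupp.single_eq_same]
    push_cast
    ring

section CharP

variable (p : ℕ) [Fact p.Prime] [CharP R p]

/-- `(d/dz)ᵖ = 0` on `R⟦z⟧` in characteristic `p`. [folklore] -/
theorem iterate_prime_derivative_eq_zero (f : R⟦X⟧) : (d⁄dX R)^[p] f = 0 := by
  have hp : p.Prime := Fact.out
  ext n
  rw [coeff_iterate_derivative, map_zero]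
  have hdvd : p ∣ (n + 1).ascFactorial p :=
    (Nat.dvd_factorial hp.pos le_rfl).trans (Nat.factorial_dvd_ascFactorial _ _)
  rw [(CharP.cast_eq_zero_iff R p _).mpr hdvd, zero_mul]

/-- `∂ᵢᵖ = 0` on `R⟦(x_j)_j⟧` in characteristic `p`. [folklore] -/
theorem iterate_prime_pderiv_eq_zero {σ : Type*} (i : σ) (f : MvPowerSeries σ R) :
    (MvPowerSeries.pderiv i)^[p] f = 0 := by
  have hp : p.Prime := Fact.out
  ext e
  rw [coeff_iterate_pderiv, map_zero]
  have hdvd : p ∣ (e i + 1).ascFactorial p :=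
    (Nat.dvd_factorial hp.pos le_rfl).trans (Nat.factorial_dvd_ascFactorial _ _)
  rw [(CharP.cast_eq_zero_iff R p _).mpr hdvd, zero_mul]

omit [Fact p.Prime] in
/-- `R⟦(x_j)_j⟧` has characteristic `p` when `R` has (Mathlib records this for polynomial rings
only; a theorem, used locally via `haveI`). [folklore] -/
theorem charP_mvPowerSeries (σ : Type*) : CharP (MvPowerSeries σ R) p := by
  refine ⟨fun n => ?_⟩
  rw [← map_natCast (MvPowerSeries.C : R →+* MvPowerSeries σ R) n, ← CharP.cast_eq_zero_iff R p n]
  refine ⟨fun h => ?_, fun h => by rw [h, map_zero]⟩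
  simpa using congrArg (MvPowerSeries.constantCoeff : MvPowerSeries σ R →+* R) h

/-- Wilson in `R`: `(qp+1)(qp+2)⋯(qp+p-1) = (p-1)! = -1` in characteristic `p`. [folklore] -/
theorem cast_ascFactorial_mul_prime_add_one (q : ℕ) :
    ((q * p + 1).ascFactorial (p - 1) : R) = -1 := by
  have hp : p.Prime := Fact.out
  have h1 : ((q * p + 1).ascFactorial (p - 1) : R) = ((p - 1).factorial : R) := by
    rw [Nat.ascFactorial_eq_prod_range, ← prod_range_add_one_eq_factorial, Nat.cast_prod,
      Nat.cast_prod]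
    refine prod_congr rfl fun i _ => ?_
    have h0 : (q : R) * (p : R) = 0 := by
      rw [← Nat.cast_mul]; exact (CharP.cast_eq_zero_iff R p _).mpr (dvd_mul_left p q)
    push_cast
    rw [h0]
    ring
  have h2 := congrArg (ZMod.castHom (dvd_refl p) R) (ZMod.wilsons_lemma (p := p))
  rw [map_natCast, map_neg, map_one] at h2
  rw [h1, h2]

/-- `p ∣ (n+1)(n+2)⋯(n+p-1)` when `p ∤ n`, i.e. the product vanishes in characteristic `p`.
[folklore] -/
theorem cast_ascFactorial_eq_zero_of_not_dvd {n : ℕ} (hn : ¬ p ∣ n) :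
    ((n + 1).ascFactorial (p - 1) : R) = 0 := by
  have hp : p.Prime := Fact.out
  apply (CharP.cast_eq_zero_iff R p _).mpr
  rw [Nat.ascFactorial_eq_prod_range]
  have hr : 0 < n % p := Nat.pos_of_ne_zero fun h => hn (Nat.dvd_of_mod_eq_zero h)
  have hrp : n % p < p := Nat.mod_lt _ hp.pos
  have hmem : p - 1 - n % p ∈ range (p - 1) := mem_range.mpr (by omega)
  refine (Dvd.intro (n / p + 1) ?_).trans (dvd_prod_of_mem _ hmem)
  have := Nat.div_add_mod n p
  -- `p (n/p + 1) = n + 1 + (p - 1 - n % p)`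
  rw [Nat.mul_add, mul_one]
  generalize p * (n / p) = P at this ⊢
  omega

end CharP

end Literature.NumberTheory.EllipticCurves

namespace WeierstrassCurve

open Literature.NumberTheory.EllipticCurves

variable {R : Type*} [CommRing R]

/-! ### `(d/dz)^{p-1} ω = -A ωᵖ` -/

section CharP

variable (p : ℕ) [Fact p.Prime] [CharP R p]

/-- **`(d/dz)^{p-1} ω + A·ωᵖ = 0`** in characteristic `p` (odd), for the invariant differential
`ω = Σ cₙ zⁿ dz` of a Weierstrass curve and its Hasse invariant `A`: coefficientwise this is
`(n+1)⋯(n+p-1)·c_{n+p-1} = -A·[p ∣ n]·c_{n/p}^p`, i.e. Wilson's theorem and the level-one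
Atkin–Swinnerton-Dyer identity `c_{mp+p-1} = A·c_m^p` (`coeff_formalInvDiff_mul_prime`).
[cite: Bost2001AlgebraicLeaves, §2.3.1 footnote (2)] -/
theorem iterate_derivative_formalInvDiff_add_smul_pow (W : WeierstrassCurve R) {m : ℕ}
    (hpm : p = 2 * m + 1) :
    (d⁄dX R)^[p - 1] W.formalInvDiff + W.hasseCoeff p • W.formalInvDiff ^ p = 0 := by
  have hp : p.Prime := Fact.out
  ext n
  rw [map_add, Literature.NumberTheory.EllipticCurves.coeff_iterate_derivative, coeff_smul,
    coeff_pow_prime p W.formalInvDiff n, map_zero]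
  obtain ⟨q, r, hr, rfl⟩ : ∃ q r, r < p ∧ n = q * p + r :=
    ⟨n / p, n % p, Nat.mod_lt _ hp.pos, (Nat.div_add_mod' n p).symm⟩
  by_cases hr0 : r = 0
  · subst hr0
    have hdvd : p ∣ q * p + 0 := by rw [add_zero]; exact dvd_mul_left p q
    rw [if_pos hdvd, show q * p + 0 = q * p from add_zero _, Nat.mul_div_cancel q hp.pos,
      cast_ascFactorial_mul_prime_add_one p q,
      show q * p + (p - 1) = q * p + (p - 1) from rfl, W.coeff_formalInvDiff_mul_prime p hpm q,
      smul_eq_mul]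
    ring
  · have hndvd : ¬ p ∣ q * p + r := fun h =>
      hr0 (Nat.eq_zero_of_dvd_of_lt ((Nat.dvd_add_right (dvd_mul_left p q)).mp h) hr)
    rw [if_neg hndvd, smul_zero, add_zero, cast_ascFactorial_eq_zero_of_not_dvd p hndvd,
      zero_mul]

end CharP

/-! ### One-variable series read in a variable of `R⟦(x_j)_j⟧` -/

section Embed

variable {σ : Type*} [DecidableEq σ]

/-- `∂ᵢᵐ (g(xᵢ)) = g⁽ᵐ⁾(xᵢ)`. [folklore] -/
theorem _root_.Literature.NumberTheory.EllipticCurves.iterate_pderiv_subst_X (i : σ) (g : R⟦X⟧)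
    (m : ℕ) :
    (MvPowerSeries.pderiv i)^[m] (g.subst (MvPowerSeries.X i : MvPowerSeries σ R)) =
      ((d⁄dX R)^[m] g).subst (MvPowerSeries.X i : MvPowerSeries σ R) := by
  induction m generalizing g with
  | zero => rfl
  | succ m ih =>
    rw [Function.iterate_succ_apply, Function.iterate_succ_apply,
      MvPowerSeries.pderiv_powerSeries_subst_X, if_pos rfl, ih]

/-- `∂ᵢ (g(xᵢ)) = g'(xᵢ)`. [folklore] -/
theorem _root_.Literature.NumberTheory.EllipticCurves.pderiv_subst_X_self (i : σ) (g : R⟦X⟧) :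
    MvPowerSeries.pderiv i (g.subst (MvPowerSeries.X i : MvPowerSeries σ R)) =
      (d⁄dX R g).subst (MvPowerSeries.X i : MvPowerSeries σ R) := by
  rw [MvPowerSeries.pderiv_powerSeries_subst_X, if_pos rfl]

/-- `∂ᵢ (g(xⱼ)) = 0` for `j ≠ i`. [folklore] -/
theorem _root_.Literature.NumberTheory.EllipticCurves.pderiv_subst_X_of_ne {i j : σ} (h : j ≠ i)
    (g : R⟦X⟧) :
    MvPowerSeries.pderiv i (g.subst (MvPowerSeries.X j : MvPowerSeries σ R)) = 0 := by
  rw [MvPowerSeries.pderiv_powerSeries_subst_X, if_neg h]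

omit [DecidableEq σ] in
/-- `(fg)(xᵢ) = f(xᵢ)g(xᵢ)`. [folklore] -/
theorem _root_.Literature.NumberTheory.EllipticCurves.subst_X_mul (i : σ) (f g : R⟦X⟧) :
    (f * g).subst (MvPowerSeries.X i : MvPowerSeries σ R) =
      f.subst (MvPowerSeries.X i : MvPowerSeries σ R) * g.subst (MvPowerSeries.X i) :=
  subst_mul (HasSubst.X i) f g

omit [DecidableEq σ] in
/-- `ω(xᵢ) · η(xᵢ) = 1`. [folklore] -/
theorem subst_X_formalInvDiff_mul_formalEta (W : WeierstrassCurve R) (i : σ) :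
    W.formalInvDiff.subst (MvPowerSeries.X i : MvPowerSeries σ R) *
        W.formalEta.subst (MvPowerSeries.X i : MvPowerSeries σ R) = 1 := by
  rw [← subst_X_mul, formalInvDiff_mul_formalEta, ← coe_substAlgHom (HasSubst.X i), map_one]

omit [DecidableEq σ] in
/-- `ω(xᵢ) · Dᵢ = ∂ᵢ` as derivations of `R⟦(x_j)_j⟧`. [folklore] -/
theorem subst_X_formalInvDiff_smul_formalInvariantDerivationMv (W : WeierstrassCurve R) (i : σ) :
    W.formalInvDiff.subst (MvPowerSeries.X i : MvPowerSeries σ R) • W.formalInvariantDerivationMv i =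
      MvPowerSeries.pderiv i := by
  rw [formalInvariantDerivationMv, smul_smul, subst_X_formalInvDiff_mul_formalEta, one_smul]

end Embed

/-! ### `Dᵖ = A·D`: the `p`-th power map on `Lie` of the formal group -/

section PthPower

variable (p : ℕ) [Fact p.Prime] [CharP R p] {σ : Type*} [DecidableEq σ]

/-- **`Dᵢᵖ = A·Dᵢ`**: in odd characteristic `p`, the `p`-th iterate of the invariant derivation
`Dᵢ = η(xᵢ)∂ᵢ` of a Weierstrass curve `W` (acting on the variable `xᵢ` of `R⟦(x_j)_j⟧`) is the
Hasse invariant `A = hasseCoeff W p` times `Dᵢ` — "the `p`-th power map on `Lie E_{𝔽_p}` is the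
multiplication by the class of `a_p(E)`", `a_p ≡ A (mod p)`. Proof: Hochschild's formula for
`ω(xᵢ)·Dᵢ = ∂ᵢ` reads `0 = ∂ᵢᵖ = ω(xᵢ)ᵖ Dᵢᵖ + (∂ᵢ^{p-1}ω(xᵢ))·Dᵢ`, and `∂^{p-1}ω = -Aωᵖ`.
[cite: Bost2001AlgebraicLeaves, §2.3.1 and footnote (2)] -/
theorem iterate_prime_formalInvariantDerivationMv (hp2 : p ≠ 2) (W : WeierstrassCurve R) (i : σ)
    (f : MvPowerSeries σ R) :
    (W.formalInvariantDerivationMv i)^[p] f = W.hasseCoeff p • W.formalInvariantDerivationMv i f := by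
  have hp : p.Prime := Fact.out
  obtain ⟨m, hpm⟩ : ∃ m, p = 2 * m + 1 := hp.eq_two_or_odd'.resolve_left hp2
  haveI := charP_mvPowerSeries (R := R) p σ
  set ω := W.formalInvDiff.subst (MvPowerSeries.X i : MvPowerSeries σ R) with hω
  have hH := iterate_prime_smul_apply p (W.formalInvariantDerivationMv i) ω f
  rw [subst_X_formalInvDiff_smul_formalInvariantDerivationMv, iterate_prime_pderiv_eq_zero p i f,
    iterate_pderiv_subst_X, eq_neg_of_add_eq_zero_left
      (W.iterate_derivative_formalInvDiff_add_smul_pow p hpm),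
    ← coe_substAlgHom (HasSubst.X i), map_neg, map_smul, map_pow, coe_substAlgHom, ← hω,
    neg_mul, ← sub_eq_add_neg, eq_comm, sub_eq_zero, smul_mul_assoc] at hH
  have hu : IsUnit (ω ^ p) :=
    (isUnit_iff_exists_inv.mpr ⟨_, W.subst_X_formalInvDiff_mul_formalEta i⟩).pow p
  exact hu.mul_left_cancel (hH.trans (mul_smul_comm _ _ _).symm)

end PthPower

end WeierstrassCurve

namespace Literature.NumberTheory.EllipticCurves

variable {R : Type*} [CommRing R]

/-! ### Two curves: `θ = D_x + D'_y` and the normalised generator `ξ = ω(x)θ` -/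

/-- Partial derivatives of `R⟦(x_j)_j⟧` commute. [folklore] -/
theorem pderiv_pderiv_comm {σ : Type*} [DecidableEq σ] (i j : σ) (f : MvPowerSeries σ R) :
    MvPowerSeries.pderiv i (MvPowerSeries.pderiv j f) =
      MvPowerSeries.pderiv j (MvPowerSeries.pderiv i f) := by
  by_cases hij : i = j
  · subst hij; rfl
  ext e
  simp only [MvPowerSeries.coeff_pderiv, Finsupp.add_apply, Finsupp.single_eq_of_ne hij,
    Finsupp.single_eq_of_ne (Ne.symm hij), add_zero]
  rw [add_right_comm e]
  ring

section CharP

variable (p : ℕ) [Fact p.Prime] [CharP R p]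

/-- **`(u + v)ᵖ = uᵖ + vᵖ` for commuting linear maps** of a module over a ring of characteristic
`p` (the binomial coefficients `C(p,m)`, `0 < m < p`, kill the middle terms). [folklore] -/
theorem iterate_prime_add_apply_of_comm {M : Type*} [AddCommGroup M] [Module R M]
    (u v : M →ₗ[R] M) (h : ∀ x, u (v x) = v (u x)) (x : M) :
    (⇑(u + v))^[p] x = (⇑u)^[p] x + (⇑v)^[p] x := by
  have hp : p.Prime := Fact.out
  have hc : Commute u v := LinearMap.ext h
  rw [← Module.End.pow_apply, ← Module.End.pow_apply, ← Module.End.pow_apply, hc.add_pow,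
    LinearMap.sum_apply, sum_range_succ, Nat.choose_self, Nat.cast_one, mul_one, Nat.sub_self,
    pow_zero, mul_one]
  obtain ⟨q, hq⟩ : ∃ q, p = q + 1 := ⟨p - 1, (Nat.succ_pred_eq_of_pos hp.pos).symm⟩
  rw [hq, sum_range_succ', Nat.choose_zero_right, Nat.cast_one, mul_one, pow_zero, one_mul,
    Nat.sub_zero, ← hq]
  have hmid : ∑ k ∈ range q, (u ^ (k + 1) * v ^ (p - (k + 1)) * (p.choose (k + 1) : M →ₗ[R] M)) x
      = 0 := by
    refine sum_eq_zero fun k hk => ?_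
    have hk' : k < q := mem_range.mp hk
    have hdvd : p ∣ p.choose (k + 1) := hp.dvd_choose_self (Nat.succ_ne_zero k) (by omega)
    rw [Module.End.mul_apply, Module.End.natCast_apply, ← Nat.cast_smul_eq_nsmul R,
      (CharP.cast_eq_zero_iff R p _).mpr hdvd, zero_smul, map_zero]
  rw [hmid, zero_add, add_comm]

variable {p} in
/-- **`θᵖ = A·θ` for `θ = D_x + D'_y`** when the two Weierstrass curves `W, W'` (over a ring of
odd characteristic `p`) have the same Hasse invariant `A`: `D_x` and `D'_y` commute, so
`θᵖ = D_xᵖ + D'_yᵖ = A·D_x + A·D'_y`. In Bost's words, the line spanned by `θ` in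
`Lie(E × E')_{𝔽_p}` "is stable under `p`-th power if and only if `a_p(E) = a_p(E')` holds
modulo `p`". [cite: Bost2001AlgebraicLeaves, Cor. 2.5 (proof)] -/
theorem iterate_prime_add_formalInvariantDerivationMv (hp2 : p ≠ 2) (W W' : WeierstrassCurve R)
    (hA : W.hasseCoeff p = W'.hasseCoeff p) (f : MvPowerSeries (Fin 2) R) :
    (⇑(W.formalInvariantDerivationMv (0 : Fin 2) + W'.formalInvariantDerivationMv (1 : Fin 2)))^[p] f
      = W.hasseCoeff p •
        (W.formalInvariantDerivationMv (0 : Fin 2) + W'.formalInvariantDerivationMv (1 : Fin 2)) f := by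
  set D₀ := W.formalInvariantDerivationMv (0 : Fin 2) with hD₀
  set D₁ := W'.formalInvariantDerivationMv (1 : Fin 2) with hD₁
  have hcomm : ∀ x, (D₀ : MvPowerSeries (Fin 2) R →ₗ[R] MvPowerSeries (Fin 2) R)
      ((D₁ : MvPowerSeries (Fin 2) R →ₗ[R] MvPowerSeries (Fin 2) R) x) =
      (D₁ : MvPowerSeries (Fin 2) R →ₗ[R] MvPowerSeries (Fin 2) R)
      ((D₀ : MvPowerSeries (Fin 2) R →ₗ[R] MvPowerSeries (Fin 2) R) x) := by
    intro x
    simp only [Derivation.coeFn_coe, hD₀, hD₁, WeierstrassCurve.formalInvariantDerivationMv_apply,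
      Derivation.leibniz, smul_eq_mul, pderiv_subst_X_of_ne (zero_ne_one (α := Fin 2)),
      pderiv_subst_X_of_ne (zero_ne_one (α := Fin 2)).symm, mul_zero, add_zero]
    rw [pderiv_pderiv_comm]
    ring
  have hcoe : ⇑(D₀ + D₁) = ⇑((D₀ : MvPowerSeries (Fin 2) R →ₗ[R] MvPowerSeries (Fin 2) R) +
      (D₁ : MvPowerSeries (Fin 2) R →ₗ[R] MvPowerSeries (Fin 2) R)) := by
    ext x; rfl
  rw [hcoe, iterate_prime_add_apply_of_comm p _ _ hcomm, Derivation.coeFn_coe, Derivation.coeFn_coe,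
    WeierstrassCurve.iterate_prime_formalInvariantDerivationMv p hp2,
    WeierstrassCurve.iterate_prime_formalInvariantDerivationMv p hp2, ← hA, LinearMap.add_apply,
    Derivation.coeFn_coe, Derivation.coeFn_coe, smul_add]

omit [Fact p.Prime] [CharP R p] in
/-- **The normalised generator is `ξ = ∂ₓ + ω(x)η'(y)·∂_y`**: `ω(x)·(D_x + D'_y) f =
∂ₓf + ω(x)η'(y)·∂_yf` (`ω(x)η(x) = 1`). [cite: Bost2001AlgebraicLeaves, §3.4.1] -/
theorem leafDerivation_apply (W W' : WeierstrassCurve R) (f : MvPowerSeries (Fin 2) R) :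
    (W.formalInvDiff.subst (MvPowerSeries.X 0 : MvPowerSeries (Fin 2) R) •
        (W.formalInvariantDerivationMv (0 : Fin 2) + W'.formalInvariantDerivationMv (1 : Fin 2))) f =
      MvPowerSeries.pderiv 0 f +
        W.formalInvDiff.subst (MvPowerSeries.X 0 : MvPowerSeries (Fin 2) R) *
          W'.formalEta.subst (MvPowerSeries.X 1 : MvPowerSeries (Fin 2) R) * MvPowerSeries.pderiv 1 f := by
  rw [Derivation.smul_apply, Derivation.add_apply, smul_eq_mul, mul_add,
    WeierstrassCurve.formalInvariantDerivationMv_apply, WeierstrassCurve.formalInvariantDerivationMv_apply,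
    ← mul_assoc, W.subst_X_formalInvDiff_mul_formalEta, one_mul, ← mul_assoc]

omit [Fact p.Prime] [CharP R p] in
/-- **`ξ` is `d/dx` on series in `x` alone**: `ξᵐ(g(x)) = g⁽ᵐ⁾(x)`. [folklore] -/
theorem iterate_leafDerivation_subst_X_zero (W W' : WeierstrassCurve R) (g : R⟦X⟧) (m : ℕ) :
    (⇑(W.formalInvDiff.subst (MvPowerSeries.X 0 : MvPowerSeries (Fin 2) R) •
        (W.formalInvariantDerivationMv (0 : Fin 2) + W'.formalInvariantDerivationMv (1 : Fin 2))))^[m]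
        (g.subst (MvPowerSeries.X 0 : MvPowerSeries (Fin 2) R)) =
      ((d⁄dX R)^[m] g).subst (MvPowerSeries.X 0 : MvPowerSeries (Fin 2) R) := by
  induction m generalizing g with
  | zero => rfl
  | succ m ih =>
    rw [Function.iterate_succ_apply, Function.iterate_succ_apply, ← ih, leafDerivation_apply,
      pderiv_subst_X_of_ne (zero_ne_one (α := Fin 2)), mul_zero, add_zero, pderiv_subst_X_self]

variable {p} in
/-- **The formal leaf is `p`-closed: `ξᵖ = 0`** for `ξ = ω(x)·(D_x + D'_y) = ∂ₓ + ω(x)η'(y)∂_y`,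
when `W, W'` are Weierstrass curves over a ring of odd characteristic `p` with the same Hasse
invariant. By Hochschild's formula, `ξᵖ = ω(x)ᵖθᵖ + ξ^{p-1}(ω(x))·θ = (Aωᵖ + ω^{(p-1)})(x)·θ = 0`.
This is the hypothesis "the reductions modulo `p` of the vector fields `vᵢ` have vanishing `p`-th
powers" of Bost's Prop. 3.9 (2), for the foliation of `E × E'` by the line `h ⊂ Lie E ⊕ Lie E'`
of Cor. 2.5. [cite: Bost2001AlgebraicLeaves, Prop. 3.9 (2) and Cor. 2.5 (proof)] -/
theorem iterate_prime_leafDerivation_eq_zero (hp2 : p ≠ 2) (W W' : WeierstrassCurve R)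
    (hA : W.hasseCoeff p = W'.hasseCoeff p) (f : MvPowerSeries (Fin 2) R) :
    (⇑(W.formalInvDiff.subst (MvPowerSeries.X 0 : MvPowerSeries (Fin 2) R) •
        (W.formalInvariantDerivationMv (0 : Fin 2) + W'.formalInvariantDerivationMv (1 : Fin 2))))^[p] f
      = 0 := by
  have hp : p.Prime := Fact.out
  obtain ⟨m, hpm⟩ : ∃ m, p = 2 * m + 1 := hp.eq_two_or_odd'.resolve_left hp2
  haveI := charP_mvPowerSeries (R := R) p (Fin 2)
  set θ := W.formalInvariantDerivationMv (0 : Fin 2) + W'.formalInvariantDerivationMv (1 : Fin 2)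
    with hθ
  set ω := W.formalInvDiff.subst (MvPowerSeries.X 0 : MvPowerSeries (Fin 2) R) with hω
  rw [iterate_prime_smul_apply p θ ω f, hθ, iterate_prime_add_formalInvariantDerivationMv hp2 W W' hA,
    ← hθ, hω, iterate_leafDerivation_subst_X_zero, eq_neg_of_add_eq_zero_left
      (W.iterate_derivative_formalInvDiff_add_smul_pow p hpm),
    ← coe_substAlgHom (HasSubst.X (0 : Fin 2)), map_neg, map_smul, map_pow, coe_substAlgHom, ← hω,
    mul_smul_comm, ← smul_mul_assoc, neg_mul, add_neg_cancel]

end CharP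

end Literature.NumberTheory.EllipticCurves

end
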